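import Literature.NumberTheory.Automorphic.ArchCentralizerUnimodularOfAdelic
import Literature.NumberTheory.Automorphic.UnitaryGroupDiagTraceExplicitWeights
import Literature.NumberTheory.Automorphic.UnitaryGroupOrbitalMeasureFamilyOfLocal
import Literature.NumberTheory.Automorphic.UnitaryGroupOfLocalTorusMeasure
import HarnessLib

/-!
# An ADMISSIBLE archimedean orbital measure family of the anisotropic `U(H)` reads `ν_∞ ∕ t_∞` at EVERY rational point — the `harch` input of the
# centraliser-measure towers at singular and central classes, from admissibility alone
(Rogawski (1990), §4.3 p. 43, §14.3 p. 234; Deitmar–Echterhoff (2014), Thm. 1.5.3)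

Topic `NumberTheory/Automorphic`; namespace `Literature.NumberTheory.Automorphic.UnitaryGroup`; THEOREMS ONLY (no definition, no instance, no named fact,
no `sorry`).  Cell `pub/hodgecm-mathlib`, ENGINE T1 line `F0_T1InnerFormTraceIdentity` (crux item stmt-HodgeConjecture-24833), row (O10-s) FILE C of
F0P3a-p06 (g5).  The towers ★ (O10-c4-a) `exists_tower_ofLocal_eq_quotientMeasure` and (O10-s) FILE A `exists_tower_ofLocal_eq_quotientMeasure_of_atPoint_eq`
consume the archimedean hypothesis `harch : ∀ ν_∞ Haar, ∃ t_∞ (Haar, inversion invariant) on C(g_∞), mGi.atPoint g_∞ = ν_∞ ∕ t_∞`.  At the REGULAR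
classes the T1 line supplies it from the archimedean torus coherence (pin (xii)); at the SINGULAR and CENTRAL classes no coherence is pinned — but none is
needed for the tower: for `g = γ ⊗ 1`, `γ ∈ U(H)(L⁺)` rational and `H` ANISOTROPIC, the archimedean centraliser `U(H)(L⁺ ⊗ ℝ)_{γ_∞}` is unimodular (★
`isMulRightInvariant_arch_centralizer_of_anisotropic`, from the compact adelic quotient), so EVERY non-zero invariant measure finite on compacta on
`U(H)(L⁺ ⊗ ℝ) ⧸ U(H)(L⁺ ⊗ ℝ)_{γ_∞}` is `ν_∞ ∕ t_∞` for a (unique) two-sided Haar measure `t_∞` (★ `exists_isHaarMeasure_eq_quotientMeasure`).  Hence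
`harch` at `g_∞` follows from the ADMISSIBILITY of `mGi` at the class of `γ_∞` alone — which is what the T1 line's pin (ix-s) (SPEC-O7 erratum, O7 OWNER
WORD #13) extends to the split-semisimple classes.

* **`UnitaryGroup.exists_archCentralizerMeasure_atPoint_eq_of_admissible`** — `harch` at `archPart (γ ⊗ 1)` from admissibility of `mGi ⟦archPart (γ ⊗ 1)⟧`.
HC_CM is proved only modulo the printed citations until rung 0 closes; this file proves no printed citation (measure-theoretic plumbing).

## References
* J. D. Rogawski, *Automorphic Representations of Unitary Groups in Three Variables* (1990), §4.3 p. 43, §14.3 p. 234 [Rogawski1990].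
* A. Deitmar, S. Echterhoff, *Principles of Harmonic Analysis* (2nd ed. 2014), Thm. 1.5.3 [DeitmarEchterhoff2014].
* S. Gelbart, *Automorphic forms on adele groups* (1975), (9.13) [Gelbart1975].
-/

set_option autoImplicit false

noncomputable section

open MeasureTheory Measure Set Topology NumberField
open Literature.MeasureTheory.Group
open scoped ENNReal NNReal Matrix

namespace Literature.NumberTheory.Automorphic

namespace UnitaryGroup

variable (L : Type) [Field L] [NumberField L] [IsCMField L] {N : ℕ} (H : Matrix (Fin N) (Fin N) L)
  [MeasurableSpace (arch (↥(maximalRealSubfield L)) L (IsCMField.complexConj L) N H)]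
  [BorelSpace (arch (↥(maximalRealSubfield L)) L (IsCMField.complexConj L) N H)]
  [∀ a : arch (↥(maximalRealSubfield L)) L (IsCMField.complexConj L) N H,
    MeasurableSpace (arch (↥(maximalRealSubfield L)) L (IsCMField.complexConj L) N H ⧸
      Subgroup.centralizer ({a} : Set (arch (↥(maximalRealSubfield L)) L (IsCMField.complexConj L) N H)))]
  [∀ a : arch (↥(maximalRealSubfield L)) L (IsCMField.complexConj L) N H,
    BorelSpace (arch (↥(maximalRealSubfield L)) L (IsCMField.complexConj L) N H ⧸
      Subgroup.centralizer ({a} : Set (arch (↥(maximalRealSubfield L)) L (IsCMField.complexConj L) N H)))]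

/-- **`harch` at every rational point from admissibility** (O10-s FILE C).  `H` anisotropic, `γ ∈ U(H)(L⁺)` (ANY rational element: regular, singular or
central), `γ_∞ = archPart (γ ⊗ 1)`; `mGi` an archimedean orbital measure family whose member at `⟦γ_∞⟧` is non-zero, invariant and finite on compacta.
THEN for every two-sided Haar measure `ν_∞` on `U(H)(L⁺ ⊗ ℝ)` there is a Haar, inversion-invariant measure `t_∞` on the centraliser of `γ_∞` with
`mGi.atPoint γ_∞ = quotientMeasure C(γ_∞) t_∞ ν_∞` — the archimedean input of ★ FILE A `exists_tower_ofLocal_eq_quotientMeasure_of_atPoint_eq` at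
`γ = out c` (admissibility of `atPoint`: ★ `smulInvariantMeasure_atPoint` ∕ `isFiniteMeasureOnCompacts_atPoint` ∕ `atPoint_ne_zero`; unimodularity: ★
`isMulRightInvariant_arch_centralizer_of_adelic` over ★ `isMulRightInvariant_centralizer_cmDatum`; quotient form: ★ `exists_isHaarMeasure_eq_quotientMeasure`).
[cite: Rogawski1990, §4.3 p. 43; §14.3 p. 234] [cite: DeitmarEchterhoff2014, Thm. 1.5.3] -/
theorem exists_archCentralizerMeasure_atPoint_eq_of_admissible
    (hanis : ∀ x : Fin N → L, hermForm (cmConjRingHom L) H x x = 0 → x = 0) (γ : (cmDatum L N H).Rational)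
    (mGi : OrbitalMeasureFamily (arch (↥(maximalRealSubfield L)) L (IsCMField.complexConj L) N H))
    (hadm : mGi (ConjClasses.mk (archPart (↥(maximalRealSubfield L)) L (IsCMField.complexConj L) N H ((cmDatum L N H).toAdelic γ))) ≠ 0 ∧
      SMulInvariantMeasure (arch (↥(maximalRealSubfield L)) L (IsCMField.complexConj L) N H) _
        (mGi (ConjClasses.mk (archPart (↥(maximalRealSubfield L)) L (IsCMField.complexConj L) N H ((cmDatum L N H).toAdelic γ)))) ∧
      IsFiniteMeasureOnCompacts (mGi (ConjClasses.mk (archPart (↥(maximalRealSubfield L)) L (IsCMField.complexConj L) N H ((cmDatum L N H).toAdelic γ)))))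
    (νi : Measure (arch (↥(maximalRealSubfield L)) L (IsCMField.complexConj L) N H)) [νi.IsHaarMeasure] [νi.IsMulRightInvariant] :
    ∃ ti : Measure (Subgroup.centralizer ({archPart (↥(maximalRealSubfield L)) L (IsCMField.complexConj L) N H ((cmDatum L N H).toAdelic γ)} :
        Set (arch (↥(maximalRealSubfield L)) L (IsCMField.complexConj L) N H))),
      ∃ (_ : ti.IsHaarMeasure) (_ : ti.IsInvInvariant),
        mGi.atPoint (archPart (↥(maximalRealSubfield L)) L (IsCMField.complexConj L) N H ((cmDatum L N H).toAdelic γ)) =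
          quotientMeasure (Subgroup.centralizer ({archPart (↥(maximalRealSubfield L)) L (IsCMField.complexConj L) N H ((cmDatum L N H).toAdelic γ)} :
            Set (arch (↥(maximalRealSubfield L)) L (IsCMField.complexConj L) N H))) ti (isClosed_coe_centralizer_singleton _) νi := by
  borelize (cmDatum L N H).Adelic
  -- abbreviate the archimedean component of `γ ⊗ 1`
  set g : arch (↥(maximalRealSubfield L)) L (IsCMField.complexConj L) N H :=
    archPart (↥(maximalRealSubfield L)) L (IsCMField.complexConj L) N H ((cmDatum L N H).toAdelic γ) with hg
  have hZc : IsClosed ((Subgroup.centralizer ({g} : Set (arch (↥(maximalRealSubfield L)) L (IsCMField.complexConj L) N H)) : Subgroup _) :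
      Set (arch (↥(maximalRealSubfield L)) L (IsCMField.complexConj L) N H)) := isClosed_coe_centralizer_singleton _
  haveI : LocallyCompactSpace (Subgroup.centralizer ({g} : Set (arch (↥(maximalRealSubfield L)) L (IsCMField.complexConj L) N H))) :=
    hZc.isClosedEmbedding_subtypeVal.locallyCompactSpace
  haveI := hadm.2.1
  haveI := hadm.2.2
  haveI : SMulInvariantMeasure (arch (↥(maximalRealSubfield L)) L (IsCMField.complexConj L) N H) _ (mGi.atPoint g) :=
    mGi.smulInvariantMeasure_atPoint _
  haveI : IsFiniteMeasureOnCompacts (mGi.atPoint g) := mGi.isFiniteMeasureOnCompacts_atPoint _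
  -- the archimedean centraliser of an arithmetic point of the anisotropic `U(H)` is unimodular: every Haar measure on it is inversion invariant
  have hright : ∀ (ρ : Measure (Subgroup.centralizer ({g} : Set (arch (↥(maximalRealSubfield L)) L (IsCMField.complexConj L) N H))))
      [ρ.IsHaarMeasure], ρ.IsMulRightInvariant := fun ρ _ =>
    isMulRightInvariant_arch_centralizer_of_adelic L H ((cmDatum L N H).toAdelic γ) g hg
      (fun ρ' _ => isMulRightInvariant_centralizer_cmDatum L N H hanis (γ := (cmDatum L N H).toAdelic γ) ⟨γ, rfl⟩ ρ') ρ
  have hinv : ∀ t : Measure (Subgroup.centralizer ({g} : Set (arch (↥(maximalRealSubfield L)) L (IsCMField.complexConj L) N H))),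
      IsHaarMeasure t → t.IsInvInvariant := by
    intro t ht
    haveI : t.IsMulRightInvariant := hright t
    exact isInvInvariant_of_isMulRightInvariant_of_isClosed _ hZc t
  exact exists_isHaarMeasure_eq_quotientMeasure _ νi hinv _ (mGi.atPoint_ne_zero _ hadm.1)

end UnitaryGroup

end Literature.NumberTheory.Automorphic
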